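import Literature.Analysis.FluidPDE.FluidComputer.ThresholdLevelTableX
import HarnessLib

/-!
# Kernel run of the level-table checker over the WIDER gate-data box (all seven data within 1/300), chunks 16 … 19 (bp3 gen 13, layer 4: robustness variant X)

HONEST FRAMING: low prior, high value-of-information experiment on Tao's machine paradigm; NOT a
claim that NS blows up.

Four kernel evaluations (`decide +kernel`; no `native_decide`, no extra axioms) of `runSteps`
with the interval gate data `GIx` (all seven data within relative `1/300`, `δ ∈ [0, (1 + 1/300) δ₀]`),
25 steps each, from `Bx16` to `Bx20`.
-/

namespace Literature.Analysis.FluidPDE.FluidComputer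

namespace ThresholdLevelTable

set_option maxHeartbeats 10000000 in
set_option maxRecDepth 200000 in
/-- Chunk 16 of the wider-data-box table run (steps 400 … 424). [folklore] -/
theorem runX16 : runSteps 60 12 3 GIx RbIt Bx16 chunk16 9080207597954848 = some Bx17 := by
  decide +kernel

set_option maxHeartbeats 10000000 in
set_option maxRecDepth 200000 in
/-- Chunk 17 of the wider-data-box table run (steps 425 … 449). [folklore] -/
theorem runX17 : runSteps 60 12 3 GIx RbIt Bx17 chunk17 10806933931377166 = some Bx18 := by
  decide +kernel

set_option maxHeartbeats 10000000 in
set_option maxRecDepth 200000 in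
/-- Chunk 18 of the wider-data-box table run (steps 450 … 474). [folklore] -/
theorem runX18 : runSteps 60 12 3 GIx RbIt Bx18 chunk18 12862021020692962 = some Bx19 := by
  decide +kernel

set_option maxHeartbeats 10000000 in
set_option maxRecDepth 200000 in
/-- Chunk 19 of the wider-data-box table run (steps 475 … 499). [folklore] -/
theorem runX19 : runSteps 60 12 3 GIx RbIt Bx19 chunk19 15307911178806116 = some Bx20 := by
  decide +kernel

end ThresholdLevelTable

end Literature.Analysis.FluidPDE.FluidComputer
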